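import Mathlib.NumberTheory.ArithmeticFunction.Moebius
import Mathlib.Analysis.SpecialFunctions.Pow.Real
import HarnessLib

/-!
# Selberg's diagonalisation of the quadratic form `Σ_{h,k} x_h x_k F((h,k))`

Trunk T-ANT (`Literature/NumberTheory/Sieve`). Proofs only. The identity underlying Selberg's
`Λ²`-sieve and every mollifier computation (Selberg 1942/1946; Titchmarsh §10.11–10.12; Levinson
1974 §§3–4; Conrey 1989 §4): if `F(n) = Σ_{d|n} f(d)` for `n ≥ 1`, then for every finite set `S`
of positive integers and coefficients `x_h`,

  `Σ_{h ∈ S} Σ_{k ∈ S} x_h x_k F((h,k)) = Σ_{d} f(d) (Σ_{h ∈ S, d|h} x_h)²`,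

the outer sum over the (finite) set of divisors of elements of `S`. With `F(n) = n^s` (so
`f = φ_s = μ ∗ id^s`) and `x_h = b_h h^{−s}` this turns `Σ b_h b_k [h,k]^{−s}` into a sum of squares
(`sum_sum_mul_mul_lcm`), the starting point of the evaluation of the diagonal of a mollified mean
value (programme recorded in `Literature/NumberTheory/LFunctions/SelbergFujiiSmallGaps.lean`).
Mathlib has the special case inside its Selberg sieve
(`SelbergSieve.mainSum_lambdaSquared_eq_sum_mul_sum_sq`, squarefree divisors of `P(z)` with a
multiplicative density); the general identity is recorded here.

## Main results (all proved)

* `Literature.NumberTheory.Sieve.sum_sum_mul_mul_apply_gcd` — the identity above, the outer sum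
  taken over `S.biUnion Nat.divisors`.
* `Literature.NumberTheory.Sieve.sum_sum_mul_mul_lcm_rpow` — the `lcm` form: for real `s` and
  `f_s(d) = Σ_{e | d} μ(e) (d/e)^s`,
  `Σ_{h,k ∈ S} b_h b_k [h,k]^{−s} = Σ_d f_s(d) (Σ_{h ∈ S, d|h} b_h h^{−s})²`.

## References

* A. Selberg, *On the zeros of Riemann's zeta-function*, Skr. Norske Vid.-Akad. Oslo I 1942,
  no. 10; *Contributions to the theory of the Riemann zeta-function*, Arch. Math. Naturvid. 48
  (1946), §3.
* E. C. Titchmarsh, *The Theory of the Riemann Zeta-Function*, 2nd ed. (1986), §10.11–10.12.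
  [key `Titchmarsh1986`]
-/

open Finset Nat ArithmeticFunction
open scoped ArithmeticFunction.Moebius

namespace Literature.NumberTheory.Sieve

variable {R : Type*} [CommRing R]

/-- The set of divisors of elements of `S`: finite, contains every divisor of every `h ∈ S`
(`h ≠ 0`). [folklore] -/
theorem mem_biUnion_divisors {S : Finset ℕ} {d h : ℕ} (hh : h ∈ S) (hh0 : h ≠ 0) (hd : d ∣ h) :
    d ∈ S.biUnion Nat.divisors :=
  Finset.mem_biUnion.2 ⟨h, hh, Nat.mem_divisors.2 ⟨hd, hh0⟩⟩

/-- **Selberg's diagonalisation.** If `F(n) = Σ_{d|n} f(d)` for all `n ≥ 1` and `0 ∉ S`, then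
`Σ_{h ∈ S} Σ_{k ∈ S} x_h x_k F(gcd(h,k)) = Σ_{d ∈ D} f(d) (Σ_{h ∈ S, d|h} x_h)²`, where `D` is the
set of divisors of elements of `S`. [cite: Titchmarsh1986, §10.11] -/
theorem sum_sum_mul_mul_apply_gcd (S : Finset ℕ) (hS : 0 ∉ S) (x : ℕ → R) (f F : ℕ → R)
    (hF : ∀ n, n ≠ 0 → ∑ d ∈ n.divisors, f d = F n) :
    ∑ h ∈ S, ∑ k ∈ S, x h * x k * F (Nat.gcd h k) =
      ∑ d ∈ S.biUnion Nat.divisors, f d * (∑ h ∈ S.filter (d ∣ ·), x h) ^ 2 := by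
  classical
  set D := S.biUnion Nat.divisors with hD
  -- expand `F(gcd h k)` as a sum over `d ∈ D` with `d ∣ h`, `d ∣ k`
  have hexp : ∀ h ∈ S, ∀ k ∈ S, F (Nat.gcd h k) =
      ∑ d ∈ D, if d ∣ h ∧ d ∣ k then f d else 0 := by
    intro h hh k hk
    have hh0 : h ≠ 0 := fun h0 ↦ hS (h0 ▸ hh)
    have hg0 : Nat.gcd h k ≠ 0 := Nat.gcd_ne_zero_left hh0
    rw [← hF _ hg0, ← Finset.sum_filter]
    refine Finset.sum_congr ?_ fun _ _ ↦ rfl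
    ext d
    simp only [Nat.mem_divisors, Finset.mem_filter, Nat.dvd_gcd_iff]
    constructor
    · rintro ⟨⟨hdh, hdk⟩, -⟩
      exact ⟨mem_biUnion_divisors hh hh0 hdh, hdh, hdk⟩
    · rintro ⟨-, hdh, hdk⟩
      exact ⟨⟨hdh, hdk⟩, hg0⟩
  -- swap the sums
  calc ∑ h ∈ S, ∑ k ∈ S, x h * x k * F (Nat.gcd h k)
      = ∑ h ∈ S, ∑ k ∈ S, ∑ d ∈ D, x h * x k * (if d ∣ h ∧ d ∣ k then f d else 0) := by
        refine Finset.sum_congr rfl fun h hh ↦ Finset.sum_congr rfl fun k hk ↦ ?_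
        rw [hexp h hh k hk, Finset.mul_sum]
    _ = ∑ h ∈ S, ∑ d ∈ D, ∑ k ∈ S, x h * x k * (if d ∣ h ∧ d ∣ k then f d else 0) :=
        Finset.sum_congr rfl fun h _ ↦ Finset.sum_comm
    _ = ∑ d ∈ D, ∑ h ∈ S, ∑ k ∈ S, x h * x k * (if d ∣ h ∧ d ∣ k then f d else 0) :=
        Finset.sum_comm
    _ = ∑ d ∈ D, f d * (∑ h ∈ S.filter (d ∣ ·), x h) ^ 2 := by
        refine Finset.sum_congr rfl fun d _ ↦ ?_
        rw [sq, Finset.sum_filter, Finset.sum_mul_sum, Finset.mul_sum]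
        refine Finset.sum_congr rfl fun h _ ↦ ?_
        rw [Finset.mul_sum]
        refine Finset.sum_congr rfl fun k _ ↦ ?_
        by_cases hdh : d ∣ h
        · by_cases hdk : d ∣ k
          · simp [hdh, hdk]; ring
          · simp [hdh, hdk]
        · simp [hdh]

/-- The arithmetic function `f_s(d) = Σ_{e | d} μ(e) (d/e)^s` (Möbius transform of `n ↦ n^s`; for a
natural number `s` this is Jordan's totient `J_s`, for real `s` Selberg's `φ_s`). [folklore] -/
noncomputable def moebiusRpow (s : ℝ) (d : ℕ) : ℝ :=
  ∑ e ∈ d.divisorsAntidiagonal, (μ e.1 : ℝ) * (e.2 : ℝ) ^ s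

/-- Möbius inversion: `Σ_{d | n} f_s(d) = n^s` for `n ≥ 1`. [folklore] -/
theorem sum_divisors_moebiusRpow {s : ℝ} {n : ℕ} (hn : n ≠ 0) :
    ∑ d ∈ n.divisors, moebiusRpow s d = (n : ℝ) ^ s := by
  -- `f_s = μ * g` with `g(n) = n^s` as arithmetic functions, and `ζ * μ * g = g`
  set g : ArithmeticFunction ℝ := ⟨fun n ↦ if n = 0 then 0 else (n : ℝ) ^ s, by simp⟩ with hg
  have hfs : ∀ d, d ≠ 0 → moebiusRpow s d = ((μ : ArithmeticFunction ℝ) * g) d := by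
    intro d hd
    rw [ArithmeticFunction.mul_apply, moebiusRpow]
    refine Finset.sum_congr rfl fun e he ↦ ?_
    have he2 : e.2 ≠ 0 := by
      intro h0
      have := Nat.mem_divisorsAntidiagonal.1 he
      rw [h0, mul_zero] at this
      exact hd this.1.symm
    simp [hg, he2]
  have hsum : ∑ d ∈ n.divisors, moebiusRpow s d =
      ∑ d ∈ n.divisors, ((μ : ArithmeticFunction ℝ) * g) d :=
    Finset.sum_congr rfl fun d hd ↦ hfs d (Nat.ne_of_gt (Nat.pos_of_mem_divisors hd))
  rw [hsum, ← ArithmeticFunction.coe_mul_zeta_apply, mul_right_comm,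
    ArithmeticFunction.coe_moebius_mul_coe_zeta, one_mul]
  simp [hg, hn]

/-- **The `lcm` form** (the shape in which mollifier diagonals arrive): for a finite set `S` of
positive integers, real `s` and real coefficients `b_h`,
`Σ_{h,k ∈ S} b_h b_k [h,k]^{−s} = Σ_{d ∈ D} f_s(d) (Σ_{h ∈ S, d|h} b_h h^{−s})²`,
since `[h,k]^{−s} = h^{−s} k^{−s} (h,k)^{s}`. [cite: Titchmarsh1986, §10.11] -/
theorem sum_sum_mul_mul_lcm_rpow (S : Finset ℕ) (hS : 0 ∉ S) (b : ℕ → ℝ) (s : ℝ) :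
    ∑ h ∈ S, ∑ k ∈ S, b h * b k * ((Nat.lcm h k : ℕ) : ℝ) ^ (-s) =
      ∑ d ∈ S.biUnion Nat.divisors, moebiusRpow s d *
        (∑ h ∈ S.filter (d ∣ ·), b h * (h : ℝ) ^ (-s)) ^ 2 := by
  have h1 := sum_sum_mul_mul_apply_gcd S hS (fun h ↦ b h * (h : ℝ) ^ (-s)) (moebiusRpow s)
    (fun n ↦ (n : ℝ) ^ s) (fun n hn ↦ sum_divisors_moebiusRpow hn)
  rw [← h1]
  refine Finset.sum_congr rfl fun h hh ↦ Finset.sum_congr rfl fun k hk ↦ ?_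
  have hh0 : h ≠ 0 := fun h0 ↦ hS (h0 ▸ hh)
  have hk0 : k ≠ 0 := fun h0 ↦ hS (h0 ▸ hk)
  have hg0 : Nat.gcd h k ≠ 0 := Nat.gcd_ne_zero_left hh0
  have hhpos : (0 : ℝ) < h := by exact_mod_cast Nat.pos_of_ne_zero hh0
  have hkpos : (0 : ℝ) < k := by exact_mod_cast Nat.pos_of_ne_zero hk0
  have hgpos : (0 : ℝ) < Nat.gcd h k := by exact_mod_cast Nat.pos_of_ne_zero hg0
  have hmul : ((Nat.gcd h k : ℕ) : ℝ) * ((Nat.lcm h k : ℕ) : ℝ) = (h : ℝ) * k := by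
    exact_mod_cast Nat.gcd_mul_lcm h k
  have hlcm : ((Nat.lcm h k : ℕ) : ℝ) = (h : ℝ) * k / Nat.gcd h k := by
    rw [eq_div_iff hgpos.ne', ← hmul]; ring
  rw [hlcm, Real.div_rpow (by positivity) hgpos.le, Real.mul_rpow hhpos.le hkpos.le,
    Real.rpow_neg hgpos.le, Real.rpow_neg hhpos.le, Real.rpow_neg hkpos.le]
  have h1 : (0 : ℝ) < (h : ℝ) ^ s := Real.rpow_pos_of_pos hhpos s
  have h2 : (0 : ℝ) < (k : ℝ) ^ s := Real.rpow_pos_of_pos hkpos s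
  have h3 : (0 : ℝ) < (Nat.gcd h k : ℝ) ^ s := Real.rpow_pos_of_pos hgpos s
  field_simp

end Literature.NumberTheory.Sieve
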